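import Summits.KontsevichZagierPeriods.KontsevichZagierPeriods.Theorems.StandardPartsSpAeCongruence

/-!
# Crux `StandardParts.SpArcClosure` (stmt-KontsevichZagierPeriods-3153) — birth skeleton (`Lines/birth.lean`)

Registered skeleton (planner, mode `skeleton-register`, route re-audit bin REPAIRABLE) for the rank-2 crux
`Summit.KontsevichZagierPeriods.KontsevichZagierPeriods.Theses.StandardParts.SpArcClosure` of
route-KontsevichZagierPeriods-StandardParts: two named stubs and the kernel-checked composition `SpArcClosure_of : SpArcClosure`, whose body is the
registered implication `<stub_arcRigidity> → <stub_endpointAeEq> → SpArcClosure` (a `suffices`, no sorry of its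
own) applied to the two stubs by name (shape required by `#h21_check_skeleton`: conclusion = crux by name,
no unregistered hypotheses, sorries only inside `stub_*`).

## The line: RIGIDITY of `IntegralRep`-valued semialgebraic arcs (the crux AS TYPED)

`SpArcClosure` quantifies over arcs `R : ℝ → KZ.IntegralRep n` whose total domain
`{(x,t) | t ∈ (0,1), x ∈ dom R_t}` and total integrand are `ℚ`-semialgebraic. Every fibre of such an
arc is itself `ℚ`-semialgebraic (the fields `KZ.IntegralRep.isSemialgebraic_domain`,
`KZ.IntegralRep.isSemialgebraicFunOn_integrand`), i.e. `∅`-definable in `(ℝ, +, ·, <)`. A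
`ℚ`-semialgebraic family all of whose fibres are `∅`-definable is EVENTUALLY CONSTANT as `t → 0⁺`:
for each of the countably many `ℚ`-semialgebraic `φ` the coincidence set `T_φ = {t | S_t = φ}` is
`ℚ`-semialgebraic (Tarski–Seidenberg, tree theorem `tarski_seidenberg_real_holds`), hence a finite
union of points and intervals; the jump set `B = {t | S not locally constant at t}` is
`ℚ`-semialgebraic (Tarski–Seidenberg again) and contained in the countable set `⋃_φ (T_φ ∖ int T_φ)`,
hence finite (a countable `ℚ`-semialgebraic subset of `ℝ` is finite, cf. the tree's
`IsSemialgebraic.exists_forall_encard_fibre_one_le`); below `min B` the fibre is constant. Applied to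
the total domain (in `ℝⁿ⁺¹`) and to the total GRAPH of the integrand (in `ℝⁿ⁺²`, parameter moved to
the last coordinate) this is `stub_arcRigidity`. Then the `L¹`-endpoint hypothesis, evaluated on an
eventually constant arc, says the constant germ has the endpoint's extended integrand almost
everywhere (`stub_endpointAeEq`: an eventually constant real function tending to `0` along `𝓝[>] 0`
vanishes; an integrable function with `∫ |h| = 0` vanishes a.e.), and the landed support item
`SpAeCongruence` (`Summit.KontsevichZagierPeriods.StandardParts.SpAeCongruence_proof`,
Theorems/StandardPartsSpAeCongruence.lean) plus transitivity of `KZ.Equivalent` give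
`r₀ ~ R t₀ ~ R' t₀ ~ r₀'` for one small `t₀`.

This is exactly the reading recorded on the item by three independent route-review refuters
(notes of 2026-08-15, "MIS-TYPED: as typed it collapses to SpAeCongruence + the eventual-constancy
lemma; provable now, zero standard-part content") and in the design notes of
`Literature/NumberTheory/Transcendental/KZMoveFamily.lean` and route InequalityCost's header. The
skeleton therefore makes the crux's true content visible: BOTH stubs are calculus-free (neither
mentions `KZ.Equivalent`), the crux is provable-now modulo an L-sized definability formalisation
(`stub_arcRigidity`), and the route's standard-part mechanism lives elsewhere (raw families,
`KZTameMoveFamily.lean`). No `Disproof.lean` / Negative lemma exists for this crux (`ledger crux ls`: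
no workfiles at registration), so there is no `_false_without_` obstruction to honour.

## Stubs

* `stub_arcRigidity` (HARDEST, size L; pure real-algebraic geometry, no calculus of moves): a family of
  sets `D t ⊆ ℝⁿ` and functions `f t` on them, `t ∈ (0,1)`, with `ℚ`-semialgebraic total set and total
  function and `ℚ`-semialgebraic fibres, is constant on some `(0, ε)` (domain, and integrand on the
  domain). Natural helper split for provers (`--supports`): (a) set-family rigidity (jump set finite,
  as above); (b) graph transport (apply (a) in `ℝⁿ⁺²` to the graph after the coordinate permutation
  moving the parameter last; read off `D` by projection and `f` on `D`). Leans on: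
  `tarski_seidenberg_real_holds`, `IsSemialgebraic.preimage_comp`, `IsSemialgebraic.compl/inter/union`,
  `IsSemialgebraic.exists_forall_encard_fibre_one_le`, countability of `MvPolynomial (Fin n) ℚ`.
* `stub_endpointAeEq` (size M; measure theory only): for an arc of representations constant on
  `(0, ε)` whose extended integrands converge in `L¹` to that of `r₀` as `t → 0⁺`, every member of the
  constant germ has extended integrand a.e. equal to `r₀`'s. Leans on: `integrable_indicator_iff`,
  `KZ.IntegralRep.integrableOn`, `KZ.IntegralRep.measurableSet_domain_holds`,
  `MeasureTheory.integral_eq_zero_iff_of_nonneg`, `tendsto_nhds_unique` / `Filter.EventuallyEq` along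
  `𝓝[>] 0` (`self_mem_nhdsWithin`, `Ioo_mem_nhdsGT`).

## Composition

`SpArcClosure_of h₁ h₂`: rigidity (`h₁`) for `R` and for `R'` gives `ε, ε'`; pick
`t₀ = min ε ε' / 2 ∈ (0, ε) ∩ (0, ε') ∩ (0, 1)`; `h₂` gives the two a.e. identities at `t₀`;
`SpAeCongruence_proof` turns them into `R t₀ ~ r₀`, `R' t₀ ~ r₀'`; the fibrewise hypothesis gives
`R t₀ ~ R' t₀`; conclude by `KZ.Equivalent.symm/trans`. Real proof, no `sorry`; the only sorries of the
file are the two stub bodies.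
-/

noncomputable section

open MeasureTheory Set Filter
open scoped Topology

namespace Summit.KontsevichZagierPeriods.KontsevichZagierPeriods.Cruxes.SpArcClosure.Birth

open Literature.NumberTheory.Transcendental Literature.NumberTheory.Transcendental.KZ
open Literature.ModelTheory.ExponentialFields (IsSemialgebraic)
open Summit.KontsevichZagierPeriods.KontsevichZagierPeriods.Theses.StandardParts (SpArcClosure)
open Summit.KontsevichZagierPeriods.StandardParts (SpAeCongruence_proof)

/-- **STUB 1 (`stub_arcRigidity`, hardest, size L) — rigidity of semialgebraic families with
`ℚ`-semialgebraic fibres.** If the total set `{(x,t) | t ∈ (0,1), x ∈ D t} ⊆ ℝⁿ⁺¹` is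
`ℚ`-semialgebraic, the total function `(x,t) ↦ f t x` is a `ℚ`-semialgebraic function on it, and every
fibre `D t` and fibre function `f t|_{D t}` (`t ∈ (0,1)`) is `ℚ`-semialgebraic, then the family is
CONSTANT on some `(0, ε)`: `D s = D t` and `f s = f t` on `D t` for all `s, t ∈ (0, ε)`.
(Countably many `ℚ`-semialgebraic sets; coincidence sets `{t | D t = φ}` and the jump set are
`ℚ`-semialgebraic by Tarski–Seidenberg, so the jump set is a countable semialgebraic subset of `ℝ`,
hence finite.) [van den Dries 1998, Ch. 3 (3.7); BCR 1998, Thm. 2.2.1] -/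
theorem stub_arcRigidity :
    ∀ ⦃n : ℕ⦄ (D : ℝ → Set (Fin n → ℝ)) (f : ℝ → (Fin n → ℝ) → ℝ),
      Literature.ModelTheory.ExponentialFields.IsSemialgebraic ℚ
          {z : Fin (n + 1) → ℝ | z (Fin.last n) ∈ Set.Ioo (0:ℝ) 1 ∧ Fin.init z ∈ D (z (Fin.last n))} →
      Literature.NumberTheory.Transcendental.IsSemialgebraicFunOn ℚ
          {z : Fin (n + 1) → ℝ | z (Fin.last n) ∈ Set.Ioo (0:ℝ) 1 ∧ Fin.init z ∈ D (z (Fin.last n))}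
          (fun z => f (z (Fin.last n)) (Fin.init z)) →
      (∀ t ∈ Set.Ioo (0:ℝ) 1, Literature.ModelTheory.ExponentialFields.IsSemialgebraic ℚ (D t)) →
      (∀ t ∈ Set.Ioo (0:ℝ) 1, Literature.NumberTheory.Transcendental.IsSemialgebraicFunOn ℚ (D t) (f t)) →
      ∃ ε ∈ Set.Ioo (0:ℝ) 1, ∀ s ∈ Set.Ioo (0:ℝ) ε, ∀ t ∈ Set.Ioo (0:ℝ) ε,
        D s = D t ∧ Set.EqOn (f s) (f t) (D t) := by
  sorry

/-- **STUB 2 (`stub_endpointAeEq`, size M) — the `L¹`-endpoint of an eventually constant arc is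
attained almost everywhere.** If `R : ℝ → KZ.IntegralRep n` is constant on `(0, ε)` (same domain, same
integrand on it) and `∫ |1_{dom R_t} f_t − 1_{dom r₀} f₀| → 0` as `t → 0⁺`, then for every
`t ∈ (0, ε)` the extended integrand of `R t` equals that of `r₀` almost everywhere (the `L¹` distance is
constant on `(0, ε)` and tends to `0`, so it is `0`; both extended integrands are integrable because
representations are absolutely integrable on measurable domains). [folklore] -/
theorem stub_endpointAeEq :
    ∀ ⦃n : ℕ⦄ (R : ℝ → Literature.NumberTheory.Transcendental.KZ.IntegralRep n)
      (r₀ : Literature.NumberTheory.Transcendental.KZ.IntegralRep n) ⦃ε : ℝ⦄, ε ∈ Set.Ioo (0:ℝ) 1 →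
      (∀ s ∈ Set.Ioo (0:ℝ) ε, ∀ t ∈ Set.Ioo (0:ℝ) ε,
        (R s).domain = (R t).domain ∧ Set.EqOn (R s).integrand (R t).integrand (R t).domain) →
      Filter.Tendsto (fun t : ℝ => ∫ x, |(R t).domain.indicator (R t).integrand x
          - r₀.domain.indicator r₀.integrand x|) (𝓝[>] (0:ℝ)) (𝓝 0) →
      ∀ t ∈ Set.Ioo (0:ℝ) ε,
        (R t).domain.indicator (R t).integrand =ᵐ[MeasureTheory.volume] r₀.domain.indicator r₀.integrand := by
  sorry

/-- **Composition (kernel-checked): the crux BY NAME from the two stubs.** The `suffices` line is the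
registered implication `<stub_arcRigidity> → <stub_endpointAeEq> → SpArcClosure` (a closed term, no `sorry`
of its own), applied to the two named stubs. Proof of the implication: rigidity for `R` and `R'`, one common
small parameter `t₀`, the two a.e. identities at `t₀`, the landed support item `SpAeCongruence`
(`SpAeCongruence_proof`) and transitivity of `KZ.Equivalent`: `r₀ ~ R t₀ ~ R' t₀ ~ r₀'`.
[Kontsevich–Zagier 2001, §1.2] -/
theorem SpArcClosure_of : SpArcClosure := by
  suffices key :
      (∀ ⦃n : ℕ⦄ (D : ℝ → Set (Fin n → ℝ)) (f : ℝ → (Fin n → ℝ) → ℝ),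
        Literature.ModelTheory.ExponentialFields.IsSemialgebraic ℚ
        {z : Fin (n + 1) → ℝ | z (Fin.last n) ∈ Set.Ioo (0:ℝ) 1 ∧ Fin.init z ∈ D (z (Fin.last n))} →
        Literature.NumberTheory.Transcendental.IsSemialgebraicFunOn ℚ
        {z : Fin (n + 1) → ℝ | z (Fin.last n) ∈ Set.Ioo (0:ℝ) 1 ∧ Fin.init z ∈ D (z (Fin.last n))}
        (fun z => f (z (Fin.last n)) (Fin.init z)) →
        (∀ t ∈ Set.Ioo (0:ℝ) 1, Literature.ModelTheory.ExponentialFields.IsSemialgebraic ℚ (D t)) →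
        (∀ t ∈ Set.Ioo (0:ℝ) 1, Literature.NumberTheory.Transcendental.IsSemialgebraicFunOn ℚ (D t) (f t)) →
        ∃ ε ∈ Set.Ioo (0:ℝ) 1, ∀ s ∈ Set.Ioo (0:ℝ) ε, ∀ t ∈ Set.Ioo (0:ℝ) ε,
        D s = D t ∧ Set.EqOn (f s) (f t) (D t)) →
      (∀ ⦃n : ℕ⦄ (R : ℝ → Literature.NumberTheory.Transcendental.KZ.IntegralRep n)
        (r₀ : Literature.NumberTheory.Transcendental.KZ.IntegralRep n) ⦃ε : ℝ⦄, ε ∈ Set.Ioo (0:ℝ) 1 →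
        (∀ s ∈ Set.Ioo (0:ℝ) ε, ∀ t ∈ Set.Ioo (0:ℝ) ε,
        (R s).domain = (R t).domain ∧ Set.EqOn (R s).integrand (R t).integrand (R t).domain) →
        Filter.Tendsto (fun t : ℝ => ∫ x, |(R t).domain.indicator (R t).integrand x
        - r₀.domain.indicator r₀.integrand x|) (𝓝[>] (0:ℝ)) (𝓝 0) →
        ∀ t ∈ Set.Ioo (0:ℝ) ε,
        (R t).domain.indicator (R t).integrand =ᵐ[MeasureTheory.volume] r₀.domain.indicator r₀.integrand) →
      SpArcClosure from key stub_arcRigidity stub_endpointAeEq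
  intro h₁ h₂ n m R R' r₀ r₀' hD hF hD' hF' heq hL hL'
  -- rigidity of the two arcs
  obtain ⟨ε, hε, hR⟩ := h₁ (fun t => (R t).domain) (fun t => (R t).integrand) hD hF
    (fun t _ => (R t).isSemialgebraic_domain) (fun t _ => (R t).isSemialgebraicFunOn_integrand)
  obtain ⟨ε', hε', hR'⟩ := h₁ (fun t => (R' t).domain) (fun t => (R' t).integrand) hD' hF'
    (fun t _ => (R' t).isSemialgebraic_domain) (fun t _ => (R' t).isSemialgebraicFunOn_integrand)
  -- one common small parameter
  obtain ⟨t₀, ht₀ε, ht₀ε', ht₀1⟩ :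
      ∃ t₀ : ℝ, t₀ ∈ Set.Ioo (0:ℝ) ε ∧ t₀ ∈ Set.Ioo (0:ℝ) ε' ∧ t₀ ∈ Set.Ioo (0:ℝ) 1 := by
    have hpos : 0 < min ε ε' := lt_min hε.1 hε'.1
    have h1 : min ε ε' / 2 < ε := (half_lt_self hpos).trans_le (min_le_left _ _)
    have h2 : min ε ε' / 2 < ε' := (half_lt_self hpos).trans_le (min_le_right _ _)
    exact ⟨min ε ε' / 2, ⟨half_pos hpos, h1⟩, ⟨half_pos hpos, h2⟩, ⟨half_pos hpos, h1.trans hε.2⟩⟩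
  -- the endpoints are attained a.e. by the constant germs
  have ha : (R t₀).domain.indicator (R t₀).integrand =ᵐ[volume]
      r₀.domain.indicator r₀.integrand := h₂ R r₀ hε hR hL t₀ ht₀ε
  have hb : (R' t₀).domain.indicator (R' t₀).integrand =ᵐ[volume]
      r₀'.domain.indicator r₀'.integrand := h₂ R' r₀' hε' hR' hL' t₀ ht₀ε'
  -- a.e.-congruence (landed support item SpAeCongruence) and transitivity of KZ-equivalence
  have e₁ : KZ.Equivalent (R t₀) r₀ := SpAeCongruence_proof (R t₀) r₀ ha
  have e₂ : KZ.Equivalent (R t₀) (R' t₀) := heq t₀ ht₀1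
  have e₃ : KZ.Equivalent (R' t₀) r₀' := SpAeCongruence_proof (R' t₀) r₀' hb
  exact (e₁.symm.trans e₂).trans e₃

end Summit.KontsevichZagierPeriods.KontsevichZagierPeriods.Cruxes.SpArcClosure.Birth
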